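/-
Copyright (c) 2026. All rights reserved.
Released under Apache 2.0 license as described in the file LICENSE.
-/
import Literature.NumberTheory.GaloisRepresentations.HOneUnramifiedProcyclic
import Literature.NumberTheory.GaloisRepresentations.ContinuousCohomologyTowerLimit
import Literature.AnabelianGeometry.AbsoluteAnabelian.FreeProcyclicHOneEval
import HarnessLib

/-!
# Continuous cocycles of a free procyclic group with PROFINITE coefficients: existence and uniqueness
# of the cocycle with prescribed value at the generator; `res : H¹(G, T) ↠ H¹(N, T)^{G/N}` and
# `H¹_ur ≅ T^N/(φ − 1)T^N` for profinite `T`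

Topic `NumberTheory/GaloisRepresentations`; namespace `Literature.NumberTheory.GaloisRepresentations`.
THEOREMS ONLY (no definition, no named fact).

Let `C ≅ Ẑ` be a profinite group topologically generated by `ψ` (dense `⟨ψ⟩`, an open subgroup of
every positive index) acting on a topological module `X`.  The hypothesis (KM4) of
`HOneRestrictionOntoInvariants.lean` / `HOneUnramifiedProcyclic.lean` — every `t ∈ X` is `y(ψ)` for a
continuous `1`-cocycle `y` of `C` — is the surjectivity half of "`H¹(Ẑ, X) = X/(ψ − 1)X`".  For FINITE
discrete `X` it is the tree's `evalMod_bijective_of_dense_zpowers` (`HOneRestrictionOntoInvariantsFinite`);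
here it is proved for PROFINITE `X`, i.e. for `X = lim X_i` presented as an `ℕ`-tower of FINITE
discrete levels (`DiscreteTowerPresentation`, Neukirch–Schmidt–Wingberg II §7; e.g. a finitely
generated `ℤ_p`-representation `T = lim T/pⁱ`), WITHOUT the `lim¹` comparison (2.7.5): at each finite
level the cocycle with value `t_i` at `ψ` exists and is UNIQUE (a cocycle inflated from a finite cyclic
quotient is determined by its value at the generator), so the level cocycles are compatible and glue.

* `contOneCocycles.eq_of_apply_eq_of_dense` — on any topological group with dense `⟨ψ⟩` and Hausdorff
  coefficients, a continuous cocycle is determined by its value at `ψ`;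
* **`exists_contOneCocycles_subgroupRep_apply_eq_of_tower`** — (KM4) for a closed subgroup `C ≤ G`,
  `C ≅ Ẑ` on `ψ`, and `X : TopRep R G` with a finite-level `DiscreteTowerPresentation`;
* **`exists_resSubgroup_eq_of_conjMap_eq_of_tower`**, `exists_resSubgroup_eq_iff_forall_conjMap_eq_of_tower`
  — `res : H¹(G, X) ↠ H¹(N, X)^{G/N}` for `G ⧸ N` free procyclic and such `X`
  (`0 → H¹(G/N, T^N) → H¹(G, T) → H¹(N, T)^{G/N} → 0` exact on the right: NSW (1.6.7), `lim¹`-free;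
  Rubin, *Euler Systems*, Lemma 1.3.2 / Prop. B.2.5 (ii); Büyükboduk, JNT 129 §2.1.2);
* **`exists_vanishing_apply_eq_of_tower`** — `H¹_ur(G, T) = ker res_N ↠ T^N/(φ − 1)T^N` (with the
  injectivity `oneCocycleClass_eq_iff_of_vanishing_of_dense` of `HOneUnramifiedProcyclic`:
  `H¹(G/N, T^N) ≅ T^N/(φ − 1)T^N`, Serre, *Local Fields* XIII §1, for profinite `T`).

[cite: NeukirchSchmidtWingberg2008, II §7 (2.7.5)] [cite: SerreLocalFields1979, XIII §1 Prop. 1]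
[cite: Rubin2000, Lemma 1.3.2]
-/

noncomputable section

open CategoryTheory

universe u v

namespace Literature.NumberTheory.GaloisRepresentations

open Literature.AnabelianGeometry.AbsoluteAnabelian Literature.GroupTheory
open _root_.Subgroup _root_.Topology

/-! ### A cocycle is determined by its value at a topological generator -/

section Unique

variable {R : Type u} [CommRing R] [TopologicalSpace R]
variable {C : Type v} [Group C] [TopologicalSpace C]
variable (Y : TopRep.{v} R C)

/-- A continuous cocycle vanishing at `ψ` vanishes on `⟨ψ⟩`. [folklore] -/
private theorem contOneCocycles.apply_eq_zero_of_mem_zpowers (z : contOneCocycles Y) {ψ : C}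
    (hψ : z.1 ψ = 0) {c : C} (hc : c ∈ zpowers ψ) : z.1 c = 0 := by
  let S : Subgroup C :=
    { carrier := {c | z.1 c = 0}
      one_mem' := contOneCocycles.apply_one z
      mul_mem' := fun {a b} ha hb => by
        change z.1 (a * b) = 0
        rw [z.2 a b, ha, hb, map_zero, add_zero]
      inv_mem' := fun {a} ha => by
        change z.1 a⁻¹ = 0
        have h := z.2 a⁻¹ a
        rw [inv_mul_cancel, contOneCocycles.apply_one, ha, map_zero, add_zero] at h
        exact h.symm }
  exact (zpowers_le (H := S)).mpr hψ hc

/-- **A continuous `1`-cocycle with Hausdorff coefficients is determined by its value at a topological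
generator**: if `⟨ψ⟩` is dense in `C` and `z(ψ) = z'(ψ)` then `z = z'`.
[cite: SerreLocalFields1979, XIII §1 Prop. 1] -/
theorem contOneCocycles.eq_of_apply_eq_of_dense [T2Space Y] {ψ : C} (hdense : Dense (zpowers ψ : Set C))
    (z z' : contOneCocycles Y) (h : z.1 ψ = z'.1 ψ) : z = z' := by
  rw [← sub_eq_zero]
  refine Subtype.ext (ContinuousMap.ext fun c => ?_)
  have hψ : (z - z').1 ψ = 0 := by
    change z.1 ψ - z'.1 ψ = 0; rw [h, sub_self]
  have heq : (fun c => (z - z').1 c) = fun _ => (0 : Y) :=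
    Continuous.ext_on hdense (z - z').1.continuous continuous_const fun c hc =>
      contOneCocycles.apply_eq_zero_of_mem_zpowers Y (z - z') hψ hc
  exact congrFun heq c

end Unique

/-! ### (KM4) for profinite coefficients presented by a finite-level tower -/

section Tower

variable {R : Type v} [CommRing R] [TopologicalSpace R]
variable {G : Type v} [Group G] [TopologicalSpace G] [IsTopologicalGroup G] [CompactSpace G]
  [T2Space G] [TotallyDisconnectedSpace G]
variable (X : TopRep.{v} R G)

omit [T2Space G] in
/-- **(KM4) for profinite coefficients.** Let `C ≤ G` be a closed subgroup of a profinite group,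
topologically generated by `ψ` and with an open subgroup of every positive index (`C ≅ Ẑ`), and let
`X : TopRep R G` be presented as the limit of an `ℕ`-tower of FINITE discrete `G`-modules
(`DiscreteTowerPresentation` with finite levels — e.g. `T_p E = lim E[pⁱ]`).  Then every `t ∈ X` is the
value at `ψ` of a continuous `1`-cocycle of `C` (with values in `X`): at level `i` the cocycle with value
`t_i` exists (`H¹(Ẑ, X_i) ↠ X_i/(ψ − 1)X_i`) and is unique, so the level cocycles are compatible and
glue. [cite: NeukirchSchmidtWingberg2008, II §7 (2.7.5)] [cite: SerreLocalFields1979, XIII §1 Prop. 1] -/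
theorem exists_contOneCocycles_subgroupRep_apply_eq_of_tower (P : DiscreteTowerPresentation X)
    (hfin : ∀ i, Finite (P.obj i)) (C : Subgroup G) (hC : IsClosed (C : Set G)) {ψ : C}
    (hdense : Dense (zpowers ψ : Set C))
    (hidx : ∀ n : ℕ, 0 < n → ∃ H : Subgroup C, IsOpen (H : Set C) ∧ H.index = n) (t : X) :
    ∃ y : contOneCocycles (subgroupRep X C), y.1 ψ = t := by
  classical
  haveI : CompactSpace C := isCompact_iff_compactSpace.mp hC.isCompact
  -- level-wise: existence and uniqueness of the cocycle (as a continuous function on `C`)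
  have hlev : ∀ i, ∃ z : C(C, P.obj i),
      (∀ a b : C, z (a * b) = z a + (P.obj i).ρ (a : G) (z b)) ∧ z ψ = (P.proj i).hom t ∧
      ∀ z' : C(C, P.obj i), (∀ a b : C, z' (a * b) = z' a + (P.obj i).ρ (a : G) (z' b)) →
        z' ψ = (P.proj i).hom t → z' = z := by
    intro i
    haveI := P.discrete i
    haveI := hfin i
    haveI : ContinuousSMul ℤ (P.obj i) := ⟨continuous_of_discreteTopology⟩
    -- the level as a continuous `ℤ`-representation of `C`
    let ρi : Representation ℤ C (P.obj i) :=
      { toFun := fun c => ((P.obj i).ρ (c : G)).toLinearMap.toAddMonoidHom.toIntLinearMap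
        map_one' := by
          ext b
          change (P.obj i).ρ ((1 : C) : G) b = b
          rw [OneMemClass.coe_one, map_one]; rfl
        map_mul' := fun a b => by
          ext v
          change (P.obj i).ρ ((a * b : C) : G) v = (P.obj i).ρ (a : G) ((P.obj i).ρ (b : G) v)
          rw [Subgroup.coe_mul, map_mul]; rfl }
    let τi : ContinuousRep C ℤ (P.obj i) :=
      ⟨ρi, (P.continuous_action i).comp (continuous_subtype_val.prodMap continuous_id)⟩
    have hτi : ∀ (c : C) (b : P.obj i), τi c b = (P.obj i).ρ (c : G) b := fun _ _ => rfl
    -- existence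
    obtain ⟨cl, hcl⟩ := (evalMod_bijective_of_dense_zpowers hdense hidx τi).2
      (QuotientAddGroup.mk ((P.proj i).hom t))
    obtain ⟨z₀, rfl⟩ := oneCocycleClass_surjective _ cl
    rw [evalMod_oneCocycleClass, QuotientAddGroup.eq, mem_subOneRange_iff] at hcl
    obtain ⟨v, hv⟩ := hcl
    let z : contOneCocycles τi.toTopRep := z₀ + coboundaryCocycle τi v
    have hzψ : z.1 ψ = (P.proj i).hom t := by
      change z₀.1 ψ + (τi ψ v - v) = (P.proj i).hom t
      rw [hv]; abel
    refine ⟨z.1, fun a b => z.2 a b, hzψ, fun z' hz' hz'ψ => ?_⟩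
    -- uniqueness: `z' - z` is a cocycle vanishing at `ψ`, right-invariant under an open normal subgroup
    let w : contOneCocycles τi.toTopRep := ⟨z', hz'⟩ - z
    obtain ⟨H, hHn, hHo, -, hHw⟩ := exists_openNormal_invariant τi w
    haveI := hHn
    have hw0 : w = 0 :=
      contOneCocycles.eq_zero_of_apply_eq_zero ψ H (exists_pow_eq_mk_of_dense_zpowers hdense H hHo) w hHw
        (by change z' ψ - z.1 ψ = 0; rw [hz'ψ, hzψ, sub_self])
    have : (⟨z', hz'⟩ : contOneCocycles τi.toTopRep) = z := by
      rw [← sub_eq_zero]; exact hw0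
    exact congrArg (fun q : contOneCocycles τi.toTopRep => (q.1 : C(C, P.obj i))) this
  choose z hz hzψ huniq using hlev
  -- compatibility along the transition maps (by uniqueness at level `i`)
  have hcompat : ∀ i c, (P.tr i).hom (z (i + 1) c) = z i c := by
    intro i
    have h := huniq i (((P.tr i).hom : C(P.obj (i + 1), P.obj i)).comp (z (i + 1)))
      (fun a b => by
        change (P.tr i).hom (z (i + 1) (a * b)) = (P.tr i).hom (z (i + 1) a) +
          (P.obj i).ρ (a : G) ((P.tr i).hom (z (i + 1) b))
        rw [hz (i + 1) a b, map_add, TopRep.hom_comm_apply])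
      (by change (P.tr i).hom (z (i + 1) ψ) = (P.proj i).hom t; rw [hzψ, P.tr_proj])
    exact fun c => congrFun (congrArg DFunLike.coe h) c
  -- glue
  obtain ⟨F, hF⟩ := P.exists_continuousMap_lift (T := C) z hcompat
  refine ⟨⟨F, fun a b => P.proj_injective _ _ fun i => ?_⟩, P.proj_injective _ _ fun i => ?_⟩
  · rw [hF, hz i a b, map_add, subgroupRep_ρ_apply, TopRep.hom_comm_apply, hF, hF]
  · change (P.proj i).hom (F ψ) = (P.proj i).hom t
    rw [hF, hzψ]

end Tower

/-! ### Consequences for a free procyclic quotient -/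

section FreeProcyclic

variable {R : Type v} [CommRing R] [TopologicalSpace R]
variable {G : Type v} [Group G] [TopologicalSpace G] [IsTopologicalGroup G] [CompactSpace G]
  [T2Space G] [TotallyDisconnectedSpace G]
variable (X : TopRep.{v} R G) [T2Space X]

/-- **`res : H¹(G, T) → H¹(N, T)^{G/N}` is onto for profinite `T` and `G ⧸ N` free procyclic**:
`G` profinite, `N ⊴ G` closed, `G ⧸ N ≅ Ẑ` topologically generated by the image of `φ`, and `X` a
Hausdorff topological `G`-module with jointly continuous action presented by a finite-level
`DiscreteTowerPresentation`; every class of `H¹(N, X)` fixed by `φ` is a restriction.  For `G = Γ_K`,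
`N = I_K`: `H¹(K, T) ↠ H¹(I_K, T)^{Fr}`. [cite: Rubin2000, Lemma 1.3.2]
[cite: NeukirchSchmidtWingberg2008, (1.6.7)] -/
theorem exists_resSubgroup_eq_of_conjMap_eq_of_tower (hXc : Continuous fun p : G × X => X.ρ p.1 p.2)
    (P : DiscreteTowerPresentation X) (hfin : ∀ i, Finite (P.obj i)) (N : Subgroup G) [N.Normal]
    (hN : IsClosed (N : Set G)) (hfree : FundamentalExtension.IsFreeProcyclic (G ⧸ N)) (φ : G)
    (hφ : Dense (zpowers (QuotientGroup.mk φ : G ⧸ N) : Set (G ⧸ N)))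
    (yc : continuousCohomology 1 (subgroupRep X N)) (hinv : conjMap X N φ 1 yc = yc) :
    ∃ xc : continuousCohomology 1 X, resSubgroup X N 1 xc = yc :=
  exists_resSubgroup_eq_of_conjMap_eq_of_isFreeProcyclic X hXc N hN hfree φ hφ
    (exists_contOneCocycles_subgroupRep_apply_eq_of_tower X P hfin _ (isClosed_topologicalClosure _)
      (dense_zpowers_mk_topologicalClosure' φ)
      (exists_isOpen_index_topologicalClosure_zpowers N hN hfree φ hφ)) yc hinv

/-- **`range res = H¹(N, T)^{G}` for profinite `T`** (hypotheses as above): a class of `H¹(N, X)` is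
restricted from `G` iff it is `G`-invariant. [cite: Rubin2000, Lemma 1.3.2] [cite: NeukirchSchmidtWingberg2008, (1.6.7)] -/
theorem exists_resSubgroup_eq_iff_forall_conjMap_eq_of_tower
    (hXc : Continuous fun p : G × X => X.ρ p.1 p.2)
    (P : DiscreteTowerPresentation X) (hfin : ∀ i, Finite (P.obj i)) (N : Subgroup G) [N.Normal]
    (hN : IsClosed (N : Set G)) (hfree : FundamentalExtension.IsFreeProcyclic (G ⧸ N))
    (yc : continuousCohomology 1 (subgroupRep X N)) :
    (∃ xc : continuousCohomology 1 X, resSubgroup X N 1 xc = yc) ↔ ∀ g : G, conjMap X N g 1 yc = yc := by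
  obtain ⟨γ, hγ⟩ := hfree.exists_dense_zpowers
  obtain ⟨φ, rfl⟩ := QuotientGroup.mk_surjective γ
  exact exists_resSubgroup_eq_iff_forall_conjMap_eq_of_isFreeProcyclic X hXc N hN hfree φ hγ
    (exists_contOneCocycles_subgroupRep_apply_eq_of_tower X P hfin _ (isClosed_topologicalClosure _)
      (dense_zpowers_mk_topologicalClosure' φ)
      (exists_isOpen_index_topologicalClosure_zpowers N hN hfree φ hγ)) yc

/-- **`H¹_ur(G, T) ↠ T^N/(φ − 1)T^N` for profinite `T`**: with `X` as above and `t ∈ X^N`, there is an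
`N`-vanishing continuous cocycle `z` of `G` with `z(φ) = t`; with
`oneCocycleClass_eq_iff_of_vanishing_of_dense` and `exists_rep_vanishing_of_resSubgroup_eq_zero`
(`HOneUnramifiedProcyclic`) this is `ker(H¹(G, T) → H¹(N, T)) ≅ T^N/(φ − 1)T^N`, i.e.
`H¹(K^nr/K, T^{I}) ≅ T^{I}/(Fr − 1)T^{I}` for a local field. [cite: SerreLocalFields1979, XIII §1 Prop. 1]
[cite: Rubin2000, Lemma 1.3.2] -/
theorem exists_vanishing_apply_eq_of_tower (P : DiscreteTowerPresentation X) (hfin : ∀ i, Finite (P.obj i))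
    (N : Subgroup G) [N.Normal] (hN : IsClosed (N : Set G))
    (hfree : FundamentalExtension.IsFreeProcyclic (G ⧸ N)) (φ : G)
    (hφ : Dense (zpowers (QuotientGroup.mk φ : G ⧸ N) : Set (G ⧸ N)))
    {t : X} (ht : ∀ n : N, X.ρ (n : G) t = t) :
    ∃ z : contOneCocycles X, (∀ n : N, z.1 n = 0) ∧ z.1 φ = t :=
  exists_vanishing_apply_eq_of_isFreeProcyclic X N hN hfree φ hφ ht
    (exists_contOneCocycles_subgroupRep_apply_eq_of_tower X P hfin _ (isClosed_topologicalClosure _)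
      (dense_zpowers_mk_topologicalClosure' φ)
      (exists_isOpen_index_topologicalClosure_zpowers N hN hfree φ hφ) t)

end FreeProcyclic

end Literature.NumberTheory.GaloisRepresentations

end
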